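/-
Copyright (c) 2026 the pub-hodgecm-mathlib formalisation cell (harness21).  Prover seat hodgecm-mathlib-LH4-p14 (g4): Track A «(D-RAM) FOUR-FRAME» squad of crux H413, unit U2H (ii-H),
(ρ2b′-X) payer of record (heir) — SOCKET (C′-frame) PEELED ONCE MORE: the frame census from the LINE-MODEL CENSUS (the two line models of ★ p857255 instantiated for the
hyperbolic and the anisotropic literal, ★ p857425's `Θh = h`, the value dictionary of ★ p857396), payer MAP v2 bde9a80f (C0b-1), 2026-09-04.
-/
import Summits.HodgeConjecture.HodgeConjecture.Theorems.F0P3cDyRamFixedPointCensusTypeTwoPrelude     -- ★ p857439: brings every token of :418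
import Summits.HodgeConjecture.HodgeConjecture.Theorems.F0P3cDyRamEllipticPlaneLineModel          -- ★ p857255 (F0P3a-p01 (g32)): `exists_lineModel`
import Literature.NumberTheory.Automorphic.EllipticPlaneAsFieldLineHermitian                      -- ★ p857425 (LH4-p12 (g4)): `map_h_eq_h_of_hermitian`, `h_ne_zero_of_isUnit_det`, `pairing_single_single`
import Literature.NumberTheory.LocalFields.ValuedEmbeddingValueDictionary                        -- ★ p857396 (LH4-p12 (g4)): `v_map_eq_zpow_iff`, `exists_v_eq_pow_of_fixed`, `v_le_map_of_fixed_of_lt_one`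
import Literature.NumberTheory.Automorphic.UnitaryLatticeTreeApartment                           -- ★ `pairing_mulVec_mulVec_of_mem_unitary`
import Literature.NumberTheory.Automorphic.QuadraticLocalBaseChange                              -- ★ `valued_toPlace`
import Literature.NumberTheory.Rogawski1990.UnitaryTwoTypeTwoEdgeCount                           -- ★ `placeForm_antidiagTwo_eq_antidiag`
import HarnessLib

/-!
# F0 · P3c · line LH4 «(D-RAM) FOUR-FRAME» — unit (ii-H), leaf (ρ2b′-X): SOCKET (C′-frame) FROM THE LINE-MODEL CENSUS (the two line models instantiated)
(Rogawski 1990 §4.9; Jacobowitz 1962 §4, §7; Serre 1979 Ch. II §2)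

Cell `pub/hodgecm-mathlib`, crux H413 = `stmt-HodgeConjecture-24833` (helper lane, count-neutral); THEOREMS ONLY (no definition, no instance, no notation, no named fact, no `sorry`),
typed under the LINE FILE's scopes.  Socket served: the binder `hFrame` of ★ p857651 `…CensusOfFrame.hCensus_at_of_frameCensus` (text `SOCKET-hFrame.v2.LH4p14g4.txt`
32ba725b, payer MAP v2 `F0/P3c/LH4/LH4-p14/g4/HEAD-OF-ORGANS-MAP.v2.LH4p14g4.md` bde9a80f).

WHAT IS PROVED: **`frameCensus_of_lineModelCensus (hLM) : ‹socket (C′-frame) at (L, w, ϖ, d)›`** — the census over the eigen-package from the SAME census stated over the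
eigen-package PLUS, for the hyperbolic literal `t_h` (block `ι_w(γ_H.1)` on `W₀ = (L_w², Φ₂,w)`), a LINE MODEL `(φ, h)` of ★ `exists_lineModel` (φ semilinear bijective
`L_w² → M`, `φ(g_w x) = λ·φ x`, `ι_{w₁}⟨x, y⟩_{Φ₂} = Tr_{M∕L_w}(h·Θ(φx)·φy)`) with `Θh = h` (★ `map_h_eq_h_of_hermitian`), `h ≠ 0` (★ `h_ne_zero_of_isUnit_det`) and `h` HYPERBOLIC
(`e₀` is isotropic for `Φ₂,w = antidiag(1,1)`); for the anisotropic literal `t_a` (block `γ₁` on `(L_w², diag(d₀, d₁))`), a line model `(φ′, h′)` with `Θh′ = h′`, `h′ ≠ 0`; and the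
VALUE DICTIONARY of `ι_{w₁}` (`hjpow`, `hEval`, `hϖmax` of ★ (C1) p857559, from ★ p857396 + ★ `valued_toPlace`) — i.e. the letters of ★ (C1) `ncard_fixed_selfDual_endoGL_eq_orderForm`.
DISCHARGED HERE: `hU` (★ `pairing_mulVec_mulVec_of_mem_unitary`), `D ≠ 0` (from `D·σD = 1`), `t² − 4D ≠ 0` (type (2): else `t∕2` is a root), trace∕det of `γ₁` from its
characteristic polynomial (= that of `g_w`), hermitian-ness of `Φ₂,w` and `diag(d₀,d₁)`, `e(w₁|w) ≠ 0`.  (The anisotropy of `h′` is NOT lettered — (C0b) derives it from the frame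
equation and `η ∉ N(L_wˣ)`.)

HONEST LABEL: HC_CM is proved only modulo the 7 printed citations (2 remaining named inputs: hLiu418 = stmt-HodgeConjecture-24832, h413 = stmt-HodgeConjecture-24833) until rung 0
closes; this file is a reduction (count-neutral) — `hLM` (text `SOCKET-hLM.v1.LH4p14g4.txt`) is the OPEN line-model-census socket (payer (C0b) over ★ (C1) p857559, ★ (β)
p857610, the T5 heads, ★ T5s, ★ O-Sign, (C2), S2′); nothing in it is asserted here.  Non-vacuity (R-26): payer named; the new letters are OUTPUTS of ★ `exists_lineModel` ∕ ★ p857425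
∕ ★ p857396 at every type-(2) `γ_H`, hence inhabited wherever socket (C) is (LH4-r01 (g5) certificate 2026-09-04T05:23:27Z).

## References
* [Rogawski1990] J. D. Rogawski, *Automorphic Representations of Unitary Groups in Three Variables*, Ann. of Math. Stud. 123 (1990), §4.9 Prop. 4.9.1 (b) p. 55, Lemma 4.9.3 p. 56.
* [Jacobowitz1962] R. Jacobowitz, *Hermitian forms over local fields*, Amer. J. Math. 84 (1962), §4, §7 Thm. 7.1.
* [Serre1979] J.-P. Serre, *Local Fields*, GTM 67 (1979), Ch. II §2.
-/

set_option autoImplicit false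

noncomputable section

namespace Summit.HodgeConjecture.HodgeConjecture.Cruxes.H413.F0P3cDyRamFixedPointCensusTypeTwoCensusOfLineModels

-- THE LINES MODULE'S `open` CONTEXT (tree `Cruxes/H413/Lines/F0_P3c_DyRamFourFrame_U2H_HSide.lean`, after its `namespace`):
open MeasureTheory Measure NumberField IsDedekindDomain Topology Filter Polynomial
open Literature.NumberTheory.Automorphic Literature.NumberTheory.Automorphic.UnitaryGroup Literature.NumberTheory.Automorphic.IntegralReduction
open Literature.NumberTheory.Rogawski1990 Literature.NumberTheory.GaloisRepresentations Literature.NumberTheory.NumberFields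
open Literature.NumberTheory.Automorphic.UnitaryThreeFourFrame
open Summit.HodgeConjecture.HodgeConjecture.Cruxes.H413.F0P3cDyRamFourFrameHSideDefs
open Summit.HodgeConjecture.HodgeConjecture.Cruxes.H413.F0P3cDyRamFourFrameHFamilyDefs
open scoped Matrix MatrixGroups Classical ValuativeRel
open Summit.HodgeConjecture.HodgeConjecture.Cruxes.H413.F0P3cDyRamFourFrameHSideDefsR
open Summit.HodgeConjecture.HodgeConjecture.Cruxes.H413.F0P3cDyRamFourFrameLawDefsR (shiftT shiftR)
open Literature.NumberTheory.Automorphic.UnitaryLatticeTree Literature.NumberTheory.Automorphic.HermitianLattice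
open Literature.NumberTheory.Automorphic.EllipticPlaneAsFieldLine Literature.NumberTheory.LocalFields.ValuedEmbedding
open Literature.NumberTheory.QuadraticForms
open Summit.HodgeConjecture.HodgeConjecture.Cruxes.H413

set_option maxHeartbeats 800000 in
-- budget only: statement-heavy tokens (two nested sockets over a quadratic number field and the eigen-package).
/-- **SOCKET (C′-frame) FROM THE LINE-MODEL CENSUS** — see the module docstring. [cite: Rogawski1990, §4.9 Prop. 4.9.1 (b) p. 55, Lemma 4.9.3 p. 56] [cite: Jacobowitz1962, §4, §7 Thm. 7.1]
[cite: Serre1979, Ch. II §2] -/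
theorem frameCensus_of_lineModelCensus (L : Type) [Field L] [NumberField L] [IsCMField L]
    {v : HeightOneSpectrum (𝓞 ↥(maximalRealSubfield L))} (w : UnitaryGroup.PlacesOver L v)
    (hw : IsCMField.complexConj L • w.1 = w.1) (ϖ : (w.1.adicCompletion L)) (hϖ : Valued.v ϖ = WithZero.exp (-1 : ℤ)) (d : ℕ)
    [Fintype (Valued.ResidueField (w.1.adicCompletion L))]
    (hLM :
      ∃ V ∈ 𝓝 (1 : ((UnitaryGroup.cmDatum L 2 (Matrix.of fun i j : Fin 2 => if i.val + j.val + 1 = 2 then (1 : L) else 0)).Local v × (UnitaryGroup.cmDatum L 1 (Matrix.of fun i j : Fin 1 => if i.val + j.val + 1 = 1 then (1 : L) else 0)).Local v)), ∀ γH ∈ V, IsLocalGRegular L v γH →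
        ¬ (∃ x : (w.1.adicCompletion L), (((((γH).1.val : GL (Fin 2) (UnitaryGroup.LocalRing L v)).val.map (Pi.evalRingHom (fun w' : UnitaryGroup.PlacesOver L v => w'.1.adicCompletion L) w))).charpoly).IsRoot x) →
        ∀ (E' : Type) [Field E'] [NumberField E'] [Algebra L E'] [Algebra.IsQuadraticExtension L E'] (c₁ : E' ≃ₐ[L] E') (δ : E') (m₀ : L)
          (s : (w.1.adicCompletion L)) (w₁ : UnitaryGroup.PlacesOver E' w.1) (hw₁ : c₁ • w₁.1 = w₁.1)
          (Θ : (w₁.1.adicCompletion E') →+* (w₁.1.adicCompletion E')) (α lam : (w₁.1.adicCompletion E')),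
          c₁ ≠ 1 → c₁ δ = -δ → δ ≠ 0 → algebraMap L E' m₀ = δ ^ 2 → s ≠ 0 →
          (((γH.1.val : GL (Fin 2) (UnitaryGroup.LocalRing L v)).val.map (Pi.evalRingHom (fun w' : UnitaryGroup.PlacesOver L v => w'.1.adicCompletion L) w))).trace * (((γH.1.val : GL (Fin 2) (UnitaryGroup.LocalRing L v)).val.map (Pi.evalRingHom (fun w' : UnitaryGroup.PlacesOver L v => w'.1.adicCompletion L) w))).trace - 4 * (((γH.1.val : GL (Fin 2) (UnitaryGroup.LocalRing L v)).val.map (Pi.evalRingHom (fun w' : UnitaryGroup.PlacesOver L v => w'.1.adicCompletion L) w))).det = s * s * ((m₀ : L) : (w.1.adicCompletion L)) →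
          (((γH.1.val : GL (Fin 2) (UnitaryGroup.LocalRing L v)).val.map (Pi.evalRingHom (fun w' : UnitaryGroup.PlacesOver L v => w'.1.adicCompletion L) w))).det * (galAdicCompletionMap (L := L) (IsCMField.complexConj L) hw) (((γH.1.val : GL (Fin 2) (UnitaryGroup.LocalRing L v)).val.map (Pi.evalRingHom (fun w' : UnitaryGroup.PlacesOver L v => w'.1.adicCompletion L) w))).det = 1 → (((γH.1.val : GL (Fin 2) (UnitaryGroup.LocalRing L v)).val.map (Pi.evalRingHom (fun w' : UnitaryGroup.PlacesOver L v => w'.1.adicCompletion L) w))).trace = (((γH.1.val : GL (Fin 2) (UnitaryGroup.LocalRing L v)).val.map (Pi.evalRingHom (fun w' : UnitaryGroup.PlacesOver L v => w'.1.adicCompletion L) w))).det * (galAdicCompletionMap (L := L) (IsCMField.complexConj L) hw) (((γH.1.val : GL (Fin 2) (UnitaryGroup.LocalRing L v)).val.map (Pi.evalRingHom (fun w' : UnitaryGroup.PlacesOver L v => w'.1.adicCompletion L) w))).trace →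
          (∀ x : (w.1.adicCompletion L), x * x - (((γH.1.val : GL (Fin 2) (UnitaryGroup.LocalRing L v)).val.map (Pi.evalRingHom (fun w' : UnitaryGroup.PlacesOver L v => w'.1.adicCompletion L) w))).trace * x + (((γH.1.val : GL (Fin 2) (UnitaryGroup.LocalRing L v)).val.map (Pi.evalRingHom (fun w' : UnitaryGroup.PlacesOver L v => w'.1.adicCompletion L) w))).det ≠ 0) →
          (∀ z, galAdicCompletionMap (L := E') c₁ hw₁ (galAdicCompletionMap (L := E') c₁ hw₁ z) = z) →
          (∀ z, Valued.v (galAdicCompletionMap (L := E') c₁ hw₁ z) = Valued.v z) →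
          (∀ a, galAdicCompletionMap (L := E') c₁ hw₁ (toPlace w.1 w₁ a) = toPlace w.1 w₁ a) →
          (∀ a, Valued.v (toPlace w.1 w₁ a) ≤ 1 ↔ Valued.v a ≤ 1) →
          (∀ z : (w₁.1.adicCompletion E'), galAdicCompletionMap (L := E') c₁ hw₁ z = z ↔ ∃ a, toPlace w.1 w₁ a = z) →
          (∀ a, Θ (toPlace w.1 w₁ a) = toPlace w.1 w₁ ((galAdicCompletionMap (L := L) (IsCMField.complexConj L) hw) a)) →
          (∀ z, Θ (Θ z) = z) →
          (∀ z, Θ (galAdicCompletionMap (L := E') c₁ hw₁ z) = galAdicCompletionMap (L := E') c₁ hw₁ (Θ z)) →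
          (∀ z, Valued.v (Θ z) = Valued.v z) →
          galAdicCompletionMap (L := E') c₁ hw₁ α ≠ α →
          Valued.v α ≤ 1 →
          (∀ z : (w₁.1.adicCompletion E'), Valued.v z ≤ 1 → Valued.v ((z - galAdicCompletionMap (L := E') c₁ hw₁ z) / (α - galAdicCompletionMap (L := E') c₁ hw₁ α)) ≤ 1) →
          2 * lam = toPlace w.1 w₁ (((γH.1.val : GL (Fin 2) (UnitaryGroup.LocalRing L v)).val.map (Pi.evalRingHom (fun w' : UnitaryGroup.PlacesOver L v => w'.1.adicCompletion L) w))).trace + toPlace w.1 w₁ s * ((δ : E') : (w₁.1.adicCompletion E')) →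
          lam * lam = toPlace w.1 w₁ (((γH.1.val : GL (Fin 2) (UnitaryGroup.LocalRing L v)).val.map (Pi.evalRingHom (fun w' : UnitaryGroup.PlacesOver L v => w'.1.adicCompletion L) w))).trace * lam - toPlace w.1 w₁ (((γH.1.val : GL (Fin 2) (UnitaryGroup.LocalRing L v)).val.map (Pi.evalRingHom (fun w' : UnitaryGroup.PlacesOver L v => w'.1.adicCompletion L) w))).det →
          galAdicCompletionMap (L := E') c₁ hw₁ lam = toPlace w.1 w₁ (((γH.1.val : GL (Fin 2) (UnitaryGroup.LocalRing L v)).val.map (Pi.evalRingHom (fun w' : UnitaryGroup.PlacesOver L v => w'.1.adicCompletion L) w))).trace - lam →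
          Θ lam * lam = 1 →
          Valued.v lam = 1 →
          (∀ z : (w₁.1.adicCompletion E'), ∃! pq : (w.1.adicCompletion L) × (w.1.adicCompletion L), z = toPlace w.1 w₁ pq.1 + toPlace w.1 w₁ pq.2 * lam) →
          ∀ (th ta : ((UnitaryGroup.cmDatum L 3 (Matrix.of fun i j : Fin 3 => if i.val + j.val + 1 = 3 then (1 : L) else 0)).Local v)) (P₁ : GL (Fin 3) (w.1.adicCompletion L)) (dg : Fin 2 → (w.1.adicCompletion L)) (η : (w.1.adicCompletion L)) (γ₁ : GL (Fin 2) (w.1.adicCompletion L)),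
            ((localNonsplitEquiv (IsCMField.complexConj L) (Matrix.of fun i j : Fin 3 => if i.val + j.val + 1 = 3 then (1 : L) else 0) (IsCMField.complexConj_ne_one L) w hw th : ↥(unitaryGroupOfForm (galAdicCompletionMap (L := L) (IsCMField.complexConj L) hw) (placeForm (Matrix.of fun i j : Fin 3 => if i.val + j.val + 1 = 3 then (1 : L) else 0) w.1))) : GL (Fin 3) (w.1.adicCompletion L)) = endoGL (((localNonsplitEquiv (IsCMField.complexConj L) (Matrix.of fun i j : Fin 2 => if i.val + j.val + 1 = 2 then (1 : L) else 0) (IsCMField.complexConj_ne_one L) w hw γH.1 : ↥(unitaryGroupOfForm (galAdicCompletionMap (L := L) (IsCMField.complexConj L) hw) (placeForm (Matrix.of fun i j : Fin 2 => if i.val + j.val + 1 = 2 then (1 : L) else 0) w.1))) : GL (Fin 2) (w.1.adicCompletion L)), ((localNonsplitEquiv (IsCMField.complexConj L) (Matrix.of fun i j : Fin 1 => if i.val + j.val + 1 = 1 then (1 : L) else 0) (IsCMField.complexConj_ne_one L) w hw γH.2).val : GL (Fin 1) (w.1.adicCompletion L))) →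
            ((localNonsplitEquiv (IsCMField.complexConj L) (Matrix.of fun i j : Fin 3 => if i.val + j.val + 1 = 3 then (1 : L) else 0) (IsCMField.complexConj_ne_one L) w hw ta : ↥(unitaryGroupOfForm (galAdicCompletionMap (L := L) (IsCMField.complexConj L) hw) (placeForm (Matrix.of fun i j : Fin 3 => if i.val + j.val + 1 = 3 then (1 : L) else 0) w.1))) : GL (Fin 3) (w.1.adicCompletion L)) = P₁ * endoGL (γ₁, ((localNonsplitEquiv (IsCMField.complexConj L) (Matrix.of fun i j : Fin 1 => if i.val + j.val + 1 = 1 then (1 : L) else 0) (IsCMField.complexConj_ne_one L) w hw γH.2).val : GL (Fin 1) (w.1.adicCompletion L))) * P₁⁻¹ →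
            formCongr (galAdicCompletionMap (L := L) (IsCMField.complexConj L) hw) P₁ (placeForm (Matrix.of fun i j : Fin 3 => if i.val + j.val + 1 = 3 then (1 : L) else 0) w.1) = (!![(Matrix.diagonal dg) 0 0, 0, (Matrix.diagonal dg) 0 1; 0, η, 0; (Matrix.diagonal dg) 1 0, 0, (Matrix.diagonal dg) 1 1] : Matrix (Fin 3) (Fin 3) (w.1.adicCompletion L)) →
            (∀ i, Valued.v (dg i) = 1) →
            (∀ i, (galAdicCompletionMap (L := L) (IsCMField.complexConj L) hw) (dg i) = dg i) →
            (galAdicCompletionMap (L := L) (IsCMField.complexConj L) hw) η = η →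
            Valued.v η = 1 →
            (¬ ∃ t : (w.1.adicCompletion L), t * (galAdicCompletionMap (L := L) (IsCMField.complexConj L) hw) t = η) →
            γ₁ ∈ unitaryGroupOfForm (galAdicCompletionMap (L := L) (IsCMField.complexConj L) hw) (Matrix.diagonal dg) →
            (∀ i j, Valued.v ((γ₁ : Matrix (Fin 2) (Fin 2) (w.1.adicCompletion L)) i j) ≤ 1) →
            (γ₁ : Matrix (Fin 2) (Fin 2) (w.1.adicCompletion L)).charpoly = (((γH.1.val : GL (Fin 2) (UnitaryGroup.LocalRing L v)).val.map (Pi.evalRingHom (fun w' : UnitaryGroup.PlacesOver L v => w'.1.adicCompletion L) w))).charpoly →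
          ∀ (φ : (Fin 2 → (w.1.adicCompletion L)) →+ (w₁.1.adicCompletion E')) (h : (w₁.1.adicCompletion E')) (φ' : (Fin 2 → (w.1.adicCompletion L)) →+ (w₁.1.adicCompletion E')) (h' : (w₁.1.adicCompletion E')),
            (∀ (c : (w.1.adicCompletion L)) (x : Fin 2 → (w.1.adicCompletion L)), φ (c • x) = toPlace w.1 w₁ c * φ x) →
            Function.Injective φ →
            Function.Surjective φ →
            (∀ x, φ ((((localNonsplitEquiv (IsCMField.complexConj L) (Matrix.of fun i j : Fin 2 => if i.val + j.val + 1 = 2 then (1 : L) else 0) (IsCMField.complexConj_ne_one L) w hw γH.1 : ↥(unitaryGroupOfForm (galAdicCompletionMap (L := L) (IsCMField.complexConj L) hw) (placeForm (Matrix.of fun i j : Fin 2 => if i.val + j.val + 1 = 2 then (1 : L) else 0) w.1))) : GL (Fin 2) (w.1.adicCompletion L)) : Matrix (Fin 2) (Fin 2) (w.1.adicCompletion L)).mulVec x) = lam * φ x) →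
            (∀ x y, toPlace w.1 w₁ (pairing (galAdicCompletionMap (L := L) (IsCMField.complexConj L) hw) (placeForm (Matrix.of fun i j : Fin 2 => if i.val + j.val + 1 = 2 then (1 : L) else 0) w.1) x y) = h * Θ (φ x) * φ y + galAdicCompletionMap (L := E') c₁ hw₁ (h * Θ (φ x) * φ y)) →
            Θ h = h →
            h ≠ 0 →
            (∃ x : (w₁.1.adicCompletion E'), x ≠ 0 ∧ h * Θ x * x + galAdicCompletionMap (L := E') c₁ hw₁ (h * Θ x * x) = 0) →
            (∀ (c : (w.1.adicCompletion L)) (x : Fin 2 → (w.1.adicCompletion L)), φ' (c • x) = toPlace w.1 w₁ c * φ' x) →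
            Function.Injective φ' →
            Function.Surjective φ' →
            (∀ x, φ' ((γ₁ : Matrix (Fin 2) (Fin 2) (w.1.adicCompletion L)).mulVec x) = lam * φ' x) →
            (∀ x y, toPlace w.1 w₁ (pairing (galAdicCompletionMap (L := L) (IsCMField.complexConj L) hw) (Matrix.diagonal dg) x y) = h' * Θ (φ' x) * φ' y + galAdicCompletionMap (L := E') c₁ hw₁ (h' * Θ (φ' x) * φ' y)) →
            Θ h' = h' →
            h' ≠ 0 →
            (∀ (t : (w.1.adicCompletion L)) (n : ℤ), Valued.v (toPlace w.1 w₁ t) = Valued.v (toPlace w.1 w₁ ϖ) ^ n ↔ Valued.v t = Valued.v ϖ ^ n) →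
            (∀ c : (w₁.1.adicCompletion E'), galAdicCompletionMap (L := E') c₁ hw₁ c = c → c ≠ 0 → Valued.v c ≤ 1 → ∃ n : ℕ, Valued.v c = Valued.v (toPlace w.1 w₁ ϖ) ^ n) →
            (∀ t : (w₁.1.adicCompletion E'), galAdicCompletionMap (L := E') c₁ hw₁ t = t → Valued.v t < 1 → Valued.v t ≤ Valued.v (toPlace w.1 w₁ ϖ)) →
            ∀ (m : ℕ) (β : (v.adicCompletion ↥(maximalRealSubfield L))ˣ), Valued.v (((finCharpolyTwo L v γH).eval (finGammaTwo L v γH)) w) = Valued.v ((toPlace v w (HeckeCharacter.uniformizer ↥(maximalRealSubfield L) v : v.adicCompletion ↥(maximalRealSubfield L))) ^ m) →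
              toPlace v w (β : (v.adicCompletion ↥(maximalRealSubfield L))) = -(((finCharpolyTwo L v γH).eval (finGammaTwo L v γH)) w * (finGammaTwo L v γH w ^ 2 + ((γH.1.val.val : Matrix (Fin 2) (Fin 2) (UnitaryGroup.LocalRing L v)).map (Pi.evalRingHom (fun w' : UnitaryGroup.PlacesOver L v => w'.1.adicCompletion L) w)).det)) / (2 * finGammaTwo L v γH w ^ 2 * ((γH.1.val.val : Matrix (Fin 2) (Fin 2) (UnitaryGroup.LocalRing L v)).map (Pi.evalRingHom (fun w' : UnitaryGroup.PlacesOver L v => w'.1.adicCompletion L) w)).det) →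
              (((Fintype.card (Valued.ResidueField (w.1.adicCompletion L))) : ℤ) - 1) * ((({M : Submodule (Valued.integer (w.1.adicCompletion L)) (Fin 3 → (w.1.adicCompletion L)) | IsVertexLattice (galAdicCompletionMap (L := L) (IsCMField.complexConj L) hw) ϖ ((StdForm.antidiagonal 3).over (w.1.adicCompletion L)) 0 M ∧ mapGL ((localNonsplitEquiv (IsCMField.complexConj L) (Matrix.of fun i j : Fin 3 => if i.val + j.val + 1 = 3 then (1 : L) else 0) (IsCMField.complexConj_ne_one L) w hw th : ↥(unitaryGroupOfForm (galAdicCompletionMap (L := L) (IsCMField.complexConj L) hw) (placeForm (Matrix.of fun i j : Fin 3 => if i.val + j.val + 1 = 3 then (1 : L) else 0) w.1))) : GL (Fin 3) (w.1.adicCompletion L)) M = M}.ncard : ℕ) : ℤ) - (({M : Submodule (Valued.integer (w.1.adicCompletion L)) (Fin 3 → (w.1.adicCompletion L)) | IsVertexLattice (galAdicCompletionMap (L := L) (IsCMField.complexConj L) hw) ϖ ((StdForm.antidiagonal 3).over (w.1.adicCompletion L)) 0 M ∧ mapGL ((localNonsplitEquiv (IsCMField.complexConj L) (Matrix.of fun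 i j : Fin 3 => if i.val + j.val + 1 = 3 then (1 : L) else 0) (IsCMField.complexConj_ne_one L) w hw ta : ↥(unitaryGroupOfForm (galAdicCompletionMap (L := L) (IsCMField.complexConj L) hw) (placeForm (Matrix.of fun i j : Fin 3 => if i.val + j.val + 1 = 3 then (1 : L) else 0) w.1))) : GL (Fin 3) (w.1.adicCompletion L)) M = M}.ncard : ℕ) : ℤ)) = (Literature.NumberTheory.QuadraticForms.hilbertSymbol (v.adicCompletion ↥(maximalRealSubfield L)) (β : (v.adicCompletion ↥(maximalRealSubfield L))) (algebraMap ↥(maximalRealSubfield L) _ ((cmQuadraticGenerator L : 𝓞 ↥(maximalRealSubfield L)) : ↥(maximalRealSubfield L))) : ℤ) * ((Fintype.card (Valued.ResidueField (w.1.adicCompletion L))) : ℤ) ^ m * ((((Fintype.card (Valued.ResidueField (w.1.adicCompletion L))) : ℤ) - 1) * (((Nat.card (MulAction.fixedBy (((UnitaryGroup.cmDatum L 2 (Matrix.of fun i j : Fin 2 => if i.val + j.val + 1 = 2 then (1 : L) else 0)).Local v) ⧸ cmLocalIntegralLevel L 2 (Matrix.of fun i j : Fin 2 => if i.val + j.val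 + 1 = 2 then (1 : L) else 0) v) γH.1)) + d % 2 : ℕ) : ℤ) - 2 * (((Fintype.card (Valued.ResidueField (w.1.adicCompletion L))) : ℤ) ^ (d - d % 2) - 1))) :
    ∃ V ∈ 𝓝 (1 : ((UnitaryGroup.cmDatum L 2 (Matrix.of fun i j : Fin 2 => if i.val + j.val + 1 = 2 then (1 : L) else 0)).Local v × (UnitaryGroup.cmDatum L 1 (Matrix.of fun i j : Fin 1 => if i.val + j.val + 1 = 1 then (1 : L) else 0)).Local v)), ∀ γH ∈ V, IsLocalGRegular L v γH →
      ¬ (∃ x : (w.1.adicCompletion L), (((((γH).1.val : GL (Fin 2) (UnitaryGroup.LocalRing L v)).val.map (Pi.evalRingHom (fun w' : UnitaryGroup.PlacesOver L v => w'.1.adicCompletion L) w))).charpoly).IsRoot x) →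
      ∀ (E' : Type) [Field E'] [NumberField E'] [Algebra L E'] [Algebra.IsQuadraticExtension L E'] (c₁ : E' ≃ₐ[L] E') (δ : E') (m₀ : L)
        (s : (w.1.adicCompletion L)) (w₁ : UnitaryGroup.PlacesOver E' w.1) (hw₁ : c₁ • w₁.1 = w₁.1)
        (Θ : (w₁.1.adicCompletion E') →+* (w₁.1.adicCompletion E')) (α lam : (w₁.1.adicCompletion E')),
        c₁ ≠ 1 → c₁ δ = -δ → δ ≠ 0 → algebraMap L E' m₀ = δ ^ 2 → s ≠ 0 →
        (((γH.1.val : GL (Fin 2) (UnitaryGroup.LocalRing L v)).val.map (Pi.evalRingHom (fun w' : UnitaryGroup.PlacesOver L v => w'.1.adicCompletion L) w))).trace * (((γH.1.val : GL (Fin 2) (UnitaryGroup.LocalRing L v)).val.map (Pi.evalRingHom (fun w' : UnitaryGroup.PlacesOver L v => w'.1.adicCompletion L) w))).trace - 4 * (((γH.1.val : GL (Fin 2) (UnitaryGroup.LocalRing L v)).val.map (Pi.evalRingHom (fun w' : UnitaryGroup.PlacesOver L v => w'.1.adicCompletion L) w))).det = s * s * ((m₀ : L) : (w.1.adicCompletion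 L)) →
        (((γH.1.val : GL (Fin 2) (UnitaryGroup.LocalRing L v)).val.map (Pi.evalRingHom (fun w' : UnitaryGroup.PlacesOver L v => w'.1.adicCompletion L) w))).det * (galAdicCompletionMap (L := L) (IsCMField.complexConj L) hw) (((γH.1.val : GL (Fin 2) (UnitaryGroup.LocalRing L v)).val.map (Pi.evalRingHom (fun w' : UnitaryGroup.PlacesOver L v => w'.1.adicCompletion L) w))).det = 1 → (((γH.1.val : GL (Fin 2) (UnitaryGroup.LocalRing L v)).val.map (Pi.evalRingHom (fun w' : UnitaryGroup.PlacesOver L v => w'.1.adicCompletion L) w))).trace = (((γH.1.val : GL (Fin 2) (UnitaryGroup.LocalRing L v)).val.map (Pi.evalRingHom (fun w' : UnitaryGroup.PlacesOver L v => w'.1.adicCompletion L) w))).det * (galAdicCompletionMap (L := L) (IsCMField.complexConj L) hw) (((γH.1.val : GL (Fin 2) (UnitaryGroup.LocalRing L v)).val.map (Pi.evalRingHom (fun w' : UnitaryGroup.PlacesOver L v => w'.1.adicCompletion L) w))).trace →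
        (∀ x : (w.1.adicCompletion L), x * x - (((γH.1.val : GL (Fin 2) (UnitaryGroup.LocalRing L v)).val.map (Pi.evalRingHom (fun w' : UnitaryGroup.PlacesOver L v => w'.1.adicCompletion L) w))).trace * x + (((γH.1.val : GL (Fin 2) (UnitaryGroup.LocalRing L v)).val.map (Pi.evalRingHom (fun w' : UnitaryGroup.PlacesOver L v => w'.1.adicCompletion L) w))).det ≠ 0) →
        (∀ z, galAdicCompletionMap (L := E') c₁ hw₁ (galAdicCompletionMap (L := E') c₁ hw₁ z) = z) →
        (∀ z, Valued.v (galAdicCompletionMap (L := E') c₁ hw₁ z) = Valued.v z) →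
        (∀ a, galAdicCompletionMap (L := E') c₁ hw₁ (toPlace w.1 w₁ a) = toPlace w.1 w₁ a) →
        (∀ a, Valued.v (toPlace w.1 w₁ a) ≤ 1 ↔ Valued.v a ≤ 1) →
        (∀ z : (w₁.1.adicCompletion E'), galAdicCompletionMap (L := E') c₁ hw₁ z = z ↔ ∃ a, toPlace w.1 w₁ a = z) →
        (∀ a, Θ (toPlace w.1 w₁ a) = toPlace w.1 w₁ ((galAdicCompletionMap (L := L) (IsCMField.complexConj L) hw) a)) →
        (∀ z, Θ (Θ z) = z) →
        (∀ z, Θ (galAdicCompletionMap (L := E') c₁ hw₁ z) = galAdicCompletionMap (L := E') c₁ hw₁ (Θ z)) →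
        (∀ z, Valued.v (Θ z) = Valued.v z) →
        galAdicCompletionMap (L := E') c₁ hw₁ α ≠ α →
        Valued.v α ≤ 1 →
        (∀ z : (w₁.1.adicCompletion E'), Valued.v z ≤ 1 → Valued.v ((z - galAdicCompletionMap (L := E') c₁ hw₁ z) / (α - galAdicCompletionMap (L := E') c₁ hw₁ α)) ≤ 1) →
        2 * lam = toPlace w.1 w₁ (((γH.1.val : GL (Fin 2) (UnitaryGroup.LocalRing L v)).val.map (Pi.evalRingHom (fun w' : UnitaryGroup.PlacesOver L v => w'.1.adicCompletion L) w))).trace + toPlace w.1 w₁ s * ((δ : E') : (w₁.1.adicCompletion E')) →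
        lam * lam = toPlace w.1 w₁ (((γH.1.val : GL (Fin 2) (UnitaryGroup.LocalRing L v)).val.map (Pi.evalRingHom (fun w' : UnitaryGroup.PlacesOver L v => w'.1.adicCompletion L) w))).trace * lam - toPlace w.1 w₁ (((γH.1.val : GL (Fin 2) (UnitaryGroup.LocalRing L v)).val.map (Pi.evalRingHom (fun w' : UnitaryGroup.PlacesOver L v => w'.1.adicCompletion L) w))).det →
        galAdicCompletionMap (L := E') c₁ hw₁ lam = toPlace w.1 w₁ (((γH.1.val : GL (Fin 2) (UnitaryGroup.LocalRing L v)).val.map (Pi.evalRingHom (fun w' : UnitaryGroup.PlacesOver L v => w'.1.adicCompletion L) w))).trace - lam →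
        Θ lam * lam = 1 →
        Valued.v lam = 1 →
        (∀ z : (w₁.1.adicCompletion E'), ∃! pq : (w.1.adicCompletion L) × (w.1.adicCompletion L), z = toPlace w.1 w₁ pq.1 + toPlace w.1 w₁ pq.2 * lam) →
        ∀ (th ta : ((UnitaryGroup.cmDatum L 3 (Matrix.of fun i j : Fin 3 => if i.val + j.val + 1 = 3 then (1 : L) else 0)).Local v)) (P₁ : GL (Fin 3) (w.1.adicCompletion L)) (dg : Fin 2 → (w.1.adicCompletion L)) (η : (w.1.adicCompletion L)) (γ₁ : GL (Fin 2) (w.1.adicCompletion L)),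
          ((localNonsplitEquiv (IsCMField.complexConj L) (Matrix.of fun i j : Fin 3 => if i.val + j.val + 1 = 3 then (1 : L) else 0) (IsCMField.complexConj_ne_one L) w hw th : ↥(unitaryGroupOfForm (galAdicCompletionMap (L := L) (IsCMField.complexConj L) hw) (placeForm (Matrix.of fun i j : Fin 3 => if i.val + j.val + 1 = 3 then (1 : L) else 0) w.1))) : GL (Fin 3) (w.1.adicCompletion L)) = endoGL (((localNonsplitEquiv (IsCMField.complexConj L) (Matrix.of fun i j : Fin 2 => if i.val + j.val + 1 = 2 then (1 : L) else 0) (IsCMField.complexConj_ne_one L) w hw γH.1 : ↥(unitaryGroupOfForm (galAdicCompletionMap (L := L) (IsCMField.complexConj L) hw) (placeForm (Matrix.of fun i j : Fin 2 => if i.val + j.val + 1 = 2 then (1 : L) else 0) w.1))) : GL (Fin 2) (w.1.adicCompletion L)), ((localNonsplitEquiv (IsCMField.complexConj L) (Matrix.of fun i j : Fin 1 => if i.val + j.val + 1 = 1 then (1 : L) else 0) (IsCMField.complexConj_ne_one L) w hw γH.2).val : GL (Fin 1) (w.1.adicCompletion L))) →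
          ((localNonsplitEquiv (IsCMField.complexConj L) (Matrix.of fun i j : Fin 3 => if i.val + j.val + 1 = 3 then (1 : L) else 0) (IsCMField.complexConj_ne_one L) w hw ta : ↥(unitaryGroupOfForm (galAdicCompletionMap (L := L) (IsCMField.complexConj L) hw) (placeForm (Matrix.of fun i j : Fin 3 => if i.val + j.val + 1 = 3 then (1 : L) else 0) w.1))) : GL (Fin 3) (w.1.adicCompletion L)) = P₁ * endoGL (γ₁, ((localNonsplitEquiv (IsCMField.complexConj L) (Matrix.of fun i j : Fin 1 => if i.val + j.val + 1 = 1 then (1 : L) else 0) (IsCMField.complexConj_ne_one L) w hw γH.2).val : GL (Fin 1) (w.1.adicCompletion L))) * P₁⁻¹ →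
          formCongr (galAdicCompletionMap (L := L) (IsCMField.complexConj L) hw) P₁ (placeForm (Matrix.of fun i j : Fin 3 => if i.val + j.val + 1 = 3 then (1 : L) else 0) w.1) = (!![(Matrix.diagonal dg) 0 0, 0, (Matrix.diagonal dg) 0 1; 0, η, 0; (Matrix.diagonal dg) 1 0, 0, (Matrix.diagonal dg) 1 1] : Matrix (Fin 3) (Fin 3) (w.1.adicCompletion L)) →
          (∀ i, Valued.v (dg i) = 1) →
          (∀ i, (galAdicCompletionMap (L := L) (IsCMField.complexConj L) hw) (dg i) = dg i) →
          (galAdicCompletionMap (L := L) (IsCMField.complexConj L) hw) η = η →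
          Valued.v η = 1 →
          (¬ ∃ t : (w.1.adicCompletion L), t * (galAdicCompletionMap (L := L) (IsCMField.complexConj L) hw) t = η) →
          γ₁ ∈ unitaryGroupOfForm (galAdicCompletionMap (L := L) (IsCMField.complexConj L) hw) (Matrix.diagonal dg) →
          (∀ i j, Valued.v ((γ₁ : Matrix (Fin 2) (Fin 2) (w.1.adicCompletion L)) i j) ≤ 1) →
          (γ₁ : Matrix (Fin 2) (Fin 2) (w.1.adicCompletion L)).charpoly = (((γH.1.val : GL (Fin 2) (UnitaryGroup.LocalRing L v)).val.map (Pi.evalRingHom (fun w' : UnitaryGroup.PlacesOver L v => w'.1.adicCompletion L) w))).charpoly →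
          ∀ (m : ℕ) (β : (v.adicCompletion ↥(maximalRealSubfield L))ˣ), Valued.v (((finCharpolyTwo L v γH).eval (finGammaTwo L v γH)) w) = Valued.v ((toPlace v w (HeckeCharacter.uniformizer ↥(maximalRealSubfield L) v : v.adicCompletion ↥(maximalRealSubfield L))) ^ m) →
            toPlace v w (β : (v.adicCompletion ↥(maximalRealSubfield L))) = -(((finCharpolyTwo L v γH).eval (finGammaTwo L v γH)) w * (finGammaTwo L v γH w ^ 2 + ((γH.1.val.val : Matrix (Fin 2) (Fin 2) (UnitaryGroup.LocalRing L v)).map (Pi.evalRingHom (fun w' : UnitaryGroup.PlacesOver L v => w'.1.adicCompletion L) w)).det)) / (2 * finGammaTwo L v γH w ^ 2 * ((γH.1.val.val : Matrix (Fin 2) (Fin 2) (UnitaryGroup.LocalRing L v)).map (Pi.evalRingHom (fun w' : UnitaryGroup.PlacesOver L v => w'.1.adicCompletion L) w)).det) →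
            (((Fintype.card (Valued.ResidueField (w.1.adicCompletion L))) : ℤ) - 1) * ((({M : Submodule (Valued.integer (w.1.adicCompletion L)) (Fin 3 → (w.1.adicCompletion L)) | IsVertexLattice (galAdicCompletionMap (L := L) (IsCMField.complexConj L) hw) ϖ ((StdForm.antidiagonal 3).over (w.1.adicCompletion L)) 0 M ∧ mapGL ((localNonsplitEquiv (IsCMField.complexConj L) (Matrix.of fun i j : Fin 3 => if i.val + j.val + 1 = 3 then (1 : L) else 0) (IsCMField.complexConj_ne_one L) w hw th : ↥(unitaryGroupOfForm (galAdicCompletionMap (L := L) (IsCMField.complexConj L) hw) (placeForm (Matrix.of fun i j : Fin 3 => if i.val + j.val + 1 = 3 then (1 : L) else 0) w.1))) : GL (Fin 3) (w.1.adicCompletion L)) M = M}.ncard : ℕ) : ℤ) - (({M : Submodule (Valued.integer (w.1.adicCompletion L)) (Fin 3 → (w.1.adicCompletion L)) | IsVertexLattice (galAdicCompletionMap (L := L) (IsCMField.complexConj L) hw) ϖ ((StdForm.antidiagonal 3).over (w.1.adicCompletion L)) 0 M ∧ mapGL ((localNonsplitEquiv (IsCMField.complexConj L) (Matrix.of fun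 i j : Fin 3 => if i.val + j.val + 1 = 3 then (1 : L) else 0) (IsCMField.complexConj_ne_one L) w hw ta : ↥(unitaryGroupOfForm (galAdicCompletionMap (L := L) (IsCMField.complexConj L) hw) (placeForm (Matrix.of fun i j : Fin 3 => if i.val + j.val + 1 = 3 then (1 : L) else 0) w.1))) : GL (Fin 3) (w.1.adicCompletion L)) M = M}.ncard : ℕ) : ℤ)) = (Literature.NumberTheory.QuadraticForms.hilbertSymbol (v.adicCompletion ↥(maximalRealSubfield L)) (β : (v.adicCompletion ↥(maximalRealSubfield L))) (algebraMap ↥(maximalRealSubfield L) _ ((cmQuadraticGenerator L : 𝓞 ↥(maximalRealSubfield L)) : ↥(maximalRealSubfield L))) : ℤ) * ((Fintype.card (Valued.ResidueField (w.1.adicCompletion L))) : ℤ) ^ m * ((((Fintype.card (Valued.ResidueField (w.1.adicCompletion L))) : ℤ) - 1) * (((Nat.card (MulAction.fixedBy (((UnitaryGroup.cmDatum L 2 (Matrix.of fun i j : Fin 2 => if i.val + j.val + 1 = 2 then (1 : L) else 0)).Local v) ⧸ cmLocalIntegralLevel L 2 (Matrix.of fun i j : Fin 2 => if i.val + j.val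 + 1 = 2 then (1 : L) else 0) v) γH.1)) + d % 2 : ℕ) : ℤ) - 2 * (((Fintype.card (Valued.ResidueField (w.1.adicCompletion L))) : ℤ) ^ (d - d % 2) - 1)) := by
  classical
  haveI : Algebra.IsQuadraticExtension ↥(maximalRealSubfield L) L := IsCMField.isQuadraticExtension L
  haveI : CharZero (w.1.adicCompletion L) := charZero_of_injective_algebraMap (algebraMap L (w.1.adicCompletion L)).injective
  have hc1 : IsCMField.complexConj L ≠ 1 := IsCMField.complexConj_ne_one L
  obtain ⟨VL, hVL, hL⟩ := hLM
  refine ⟨VL, hVL, fun γH hγ hreg hirr E' _ _ _ _ c₁ δ m₀ s w₁ hw₁ Θ α lam hc₁1 hc₁ hδ0 hmδ hs hΔ hDσ htσ hirr' hP1 hP2 hP3 hP4 hP5 hP6 hP7 hP8 hP9 hP10 hP11 hP12 hP13 hP14 hP15 hP16 hP17 hP18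
    th ta P₁ dg η γ₁ hth hA1 hA2 hA3 hA4 hA7 hA8 hA9 hA10 hA11 hA12 => ?_⟩
  -- abbreviations
  set σ : (w.1.adicCompletion L) →+* (w.1.adicCompletion L) := (galAdicCompletionMap (L := L) (IsCMField.complexConj L) hw) with hσdef
  set g : Matrix (Fin 2) (Fin 2) (w.1.adicCompletion L) := ((γH.1.val : GL (Fin 2) (UnitaryGroup.LocalRing L v)).val.map (Pi.evalRingHom (fun w' : UnitaryGroup.PlacesOver L v => w'.1.adicCompletion L) w)) with hgdef
  set jE : (w.1.adicCompletion L) →+* (w₁.1.adicCompletion E') := toPlace w.1 w₁ with hjEdef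
  set ρ : (w₁.1.adicCompletion E') →+* (w₁.1.adicCompletion E') := galAdicCompletionMap (L := E') c₁ hw₁ with hρdef
  have hσσ : ∀ a, σ (σ a) = a := galAdicCompletionMap_galAdicCompletionMap_of_smul_eq (IsCMField.complexConj L) w hc1 hw
  -- `D ≠ 0` and `t² − 4D ≠ 0`
  have hD0 : g.det ≠ 0 := by
    intro h0; rw [h0, zero_mul] at hDσ; exact zero_ne_one hDσ
  have hΔ0 : g.trace * g.trace - 4 * g.det ≠ 0 := by
    intro h0
    apply hirr' (g.trace / 2)
    have e : g.trace / 2 * (g.trace / 2) - g.trace * (g.trace / 2) + g.det = -(g.trace * g.trace - 4 * g.det) / 4 := by ring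
    rw [e, h0, neg_zero, zero_div]
  -- THE HYPERBOLIC LINE MODEL: `(placeForm Φ₂ w, ι_w γ_H.1)`; the one-place matrix of `ι_w γ_H.1` IS `g_w` (rfl)
  have hmat : ((((localNonsplitEquiv (IsCMField.complexConj L) (Matrix.of fun i j : Fin 2 => if i.val + j.val + 1 = 2 then (1 : L) else 0) (IsCMField.complexConj_ne_one L) w hw γH.1 : ↥(unitaryGroupOfForm (galAdicCompletionMap (L := L) (IsCMField.complexConj L) hw) (placeForm (Matrix.of fun i j : Fin 2 => if i.val + j.val + 1 = 2 then (1 : L) else 0) w.1))) : GL (Fin 2) (w.1.adicCompletion L))) : Matrix (Fin 2) (Fin 2) (w.1.adicCompletion L)) = g := rfl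
  have hU : ∀ x y, pairing σ (placeForm (Matrix.of fun i j : Fin 2 => if i.val + j.val + 1 = 2 then (1 : L) else 0) w.1) (((((localNonsplitEquiv (IsCMField.complexConj L) (Matrix.of fun i j : Fin 2 => if i.val + j.val + 1 = 2 then (1 : L) else 0) (IsCMField.complexConj_ne_one L) w hw γH.1 : ↥(unitaryGroupOfForm (galAdicCompletionMap (L := L) (IsCMField.complexConj L) hw) (placeForm (Matrix.of fun i j : Fin 2 => if i.val + j.val + 1 = 2 then (1 : L) else 0) w.1))) : GL (Fin 2) (w.1.adicCompletion L))) : Matrix (Fin 2) (Fin 2) (w.1.adicCompletion L)).mulVec x) (((((localNonsplitEquiv (IsCMField.complexConj L) (Matrix.of fun i j : Fin 2 => if i.val + j.val + 1 = 2 then (1 : L) else 0) (IsCMField.complexConj_ne_one L) w hw γH.1 : ↥(unitaryGroupOfForm (galAdicCompletionMap (L := L) (IsCMField.complexConj L) hw) (placeForm (Matrix.of fun i j : Fin 2 => if i.val + j.val + 1 = 2 then (1 : L) else 0) w.1))) : GL (Fin 2) (w.1.adicCompletion L))) : Matrix (Fin 2) (Fin 2) (w.1.adicCompletion L)).mulVec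 y) =
      pairing σ (placeForm (Matrix.of fun i j : Fin 2 => if i.val + j.val + 1 = 2 then (1 : L) else 0) w.1) x y :=
    pairing_mulVec_mulVec_of_mem_unitary (localNonsplitEquiv (IsCMField.complexConj L) (Matrix.of fun i j : Fin 2 => if i.val + j.val + 1 = 2 then (1 : L) else 0) (IsCMField.complexConj_ne_one L) w hw γH.1).2
  have htr : ((((localNonsplitEquiv (IsCMField.complexConj L) (Matrix.of fun i j : Fin 2 => if i.val + j.val + 1 = 2 then (1 : L) else 0) (IsCMField.complexConj_ne_one L) w hw γH.1 : ↥(unitaryGroupOfForm (galAdicCompletionMap (L := L) (IsCMField.complexConj L) hw) (placeForm (Matrix.of fun i j : Fin 2 => if i.val + j.val + 1 = 2 then (1 : L) else 0) w.1))) : GL (Fin 2) (w.1.adicCompletion L))) : Matrix (Fin 2) (Fin 2) (w.1.adicCompletion L)) 0 0 + ((((localNonsplitEquiv (IsCMField.complexConj L) (Matrix.of fun i j : Fin 2 => if i.val + j.val + 1 = 2 then (1 : L) else 0) (IsCMField.complexConj_ne_one L) w hw γH.1 : ↥(unitaryGroupOfForm (galAdicCompletionMap (L := L) (IsCMField.complexConj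 L) hw) (placeForm (Matrix.of fun i j : Fin 2 => if i.val + j.val + 1 = 2 then (1 : L) else 0) w.1))) : GL (Fin 2) (w.1.adicCompletion L))) : Matrix (Fin 2) (Fin 2) (w.1.adicCompletion L)) 1 1 = g.trace := by
    rw [hmat, Matrix.trace_fin_two]
  have hdet : ((((localNonsplitEquiv (IsCMField.complexConj L) (Matrix.of fun i j : Fin 2 => if i.val + j.val + 1 = 2 then (1 : L) else 0) (IsCMField.complexConj_ne_one L) w hw γH.1 : ↥(unitaryGroupOfForm (galAdicCompletionMap (L := L) (IsCMField.complexConj L) hw) (placeForm (Matrix.of fun i j : Fin 2 => if i.val + j.val + 1 = 2 then (1 : L) else 0) w.1))) : GL (Fin 2) (w.1.adicCompletion L))) : Matrix (Fin 2) (Fin 2) (w.1.adicCompletion L)) 0 0 * ((((localNonsplitEquiv (IsCMField.complexConj L) (Matrix.of fun i j : Fin 2 => if i.val + j.val + 1 = 2 then (1 : L) else 0) (IsCMField.complexConj_ne_one L) w hw γH.1 : ↥(unitaryGroupOfForm (galAdicCompletionMap (L := L) (IsCMField.complexConj L) hw) (placeForm (Matrix.of fun i j : Fin 2 => if i.val +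 j.val + 1 = 2 then (1 : L) else 0) w.1))) : GL (Fin 2) (w.1.adicCompletion L))) : Matrix (Fin 2) (Fin 2) (w.1.adicCompletion L)) 1 1 -
      ((((localNonsplitEquiv (IsCMField.complexConj L) (Matrix.of fun i j : Fin 2 => if i.val + j.val + 1 = 2 then (1 : L) else 0) (IsCMField.complexConj_ne_one L) w hw γH.1 : ↥(unitaryGroupOfForm (galAdicCompletionMap (L := L) (IsCMField.complexConj L) hw) (placeForm (Matrix.of fun i j : Fin 2 => if i.val + j.val + 1 = 2 then (1 : L) else 0) w.1))) : GL (Fin 2) (w.1.adicCompletion L))) : Matrix (Fin 2) (Fin 2) (w.1.adicCompletion L)) 0 1 * ((((localNonsplitEquiv (IsCMField.complexConj L) (Matrix.of fun i j : Fin 2 => if i.val + j.val + 1 = 2 then (1 : L) else 0) (IsCMField.complexConj_ne_one L) w hw γH.1 : ↥(unitaryGroupOfForm (galAdicCompletionMap (L := L) (IsCMField.complexConj L) hw) (placeForm (Matrix.of fun i j : Fin 2 => if i.val + j.val + 1 = 2 then (1 : L) else 0) w.1))) : GL (Fin 2) (w.1.adicCompletion L))) : Matrix (Fin 2) (Fin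 2) (w.1.adicCompletion L)) 1 0 = g.det := by
    rw [hmat, Matrix.det_fin_two]
  obtain ⟨φ, h, hφs, hφi, hφo, hφγ, hform⟩ :=
    F0P3cDyRamEllipticPlaneLineModel.exists_lineModel σ (placeForm (Matrix.of fun i j : Fin 2 => if i.val + j.val + 1 = 2 then (1 : L) else 0) w.1) jE ρ Θ hP3 hP6 hD0 hΔ0 hP14 hP15 hP16 hP18 _ htr hdet hirr' hU
  have hH2 : ∀ a b, σ ((placeForm (Matrix.of fun i j : Fin 2 => if i.val + j.val + 1 = 2 then (1 : L) else 0) w.1) a b) = (placeForm (Matrix.of fun i j : Fin 2 => if i.val + j.val + 1 = 2 then (1 : L) else 0) w.1) b a := by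
    intro a b
    rw [UnitaryGroup.placeForm_antidiagTwo_eq_antidiag L v w]
    fin_cases a <;> fin_cases b <;> simp
  have hΘh : Θ h = h := map_h_eq_h_of_hermitian σ hσσ hH2 jE hP7 hP8 hP6 hP10 φ hφo hform
  have hdet2 : IsUnit (placeForm (Matrix.of fun i j : Fin 2 => if i.val + j.val + 1 = 2 then (1 : L) else 0) w.1).det := by
    rw [UnitaryGroup.placeForm_antidiagTwo_eq_antidiag L v w, Matrix.det_fin_two]
    simp
  have hh : h ≠ 0 := h_ne_zero_of_isUnit_det σ hdet2 jE φ hform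
  have hhyper : ∃ x : (w₁.1.adicCompletion E'), x ≠ 0 ∧ h * Θ x * x + ρ (h * Θ x * x) = 0 := by
    refine ⟨φ (Pi.single (0 : Fin 2) (1 : (w.1.adicCompletion L))), fun h0 => ?_, ?_⟩
    · have h10 : (Pi.single (0 : Fin 2) (1 : (w.1.adicCompletion L)) : Fin 2 → (w.1.adicCompletion L)) = 0 := hφi (by rw [h0, map_zero])
      have h11 := congrFun h10 0
      simp only [Pi.single_eq_same, Pi.zero_apply] at h11
      exact one_ne_zero h11
    · rw [← hform, EllipticPlaneAsFieldLine.pairing_single_single, UnitaryGroup.placeForm_antidiagTwo_eq_antidiag L v w]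
      simp
  -- THE ANISOTROPIC LINE MODEL: `(diag(d₀, d₁), γ₁)`; trace and determinant of `γ₁` from its characteristic polynomial
  have hcp : (γ₁ : Matrix (Fin 2) (Fin 2) (w.1.adicCompletion L)).charpoly = g.charpoly := hA12
  have htr' : (γ₁ : Matrix (Fin 2) (Fin 2) (w.1.adicCompletion L)) 0 0 + (γ₁ : Matrix (Fin 2) (Fin 2) (w.1.adicCompletion L)) 1 1 = g.trace := by
    have h1 := congrArg (fun p : (w.1.adicCompletion L)[X] => p.coeff 1) hcp
    simp only [Matrix.charpoly_fin_two, coeff_add, coeff_sub, coeff_X_pow, coeff_C_mul, coeff_X_one, coeff_C] at h1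
    norm_num at h1
    rw [← Matrix.trace_fin_two]
    linear_combination h1
  have hdet' : (γ₁ : Matrix (Fin 2) (Fin 2) (w.1.adicCompletion L)) 0 0 * (γ₁ : Matrix (Fin 2) (Fin 2) (w.1.adicCompletion L)) 1 1 -
      (γ₁ : Matrix (Fin 2) (Fin 2) (w.1.adicCompletion L)) 0 1 * (γ₁ : Matrix (Fin 2) (Fin 2) (w.1.adicCompletion L)) 1 0 = g.det := by
    have h0 := congrArg (fun p : (w.1.adicCompletion L)[X] => p.coeff 0) hcp
    simp only [Matrix.charpoly_fin_two, coeff_add, coeff_sub, coeff_X_pow, coeff_C_mul, coeff_X_zero, coeff_C] at h0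
    norm_num at h0
    rw [← Matrix.det_fin_two]
    linear_combination h0
  have hU' : ∀ x y, pairing σ (Matrix.diagonal dg) ((γ₁ : Matrix (Fin 2) (Fin 2) (w.1.adicCompletion L)).mulVec x) ((γ₁ : Matrix (Fin 2) (Fin 2) (w.1.adicCompletion L)).mulVec y) =
      pairing σ (Matrix.diagonal dg) x y := pairing_mulVec_mulVec_of_mem_unitary hA10
  obtain ⟨φ', h', hφ's, hφ'i, hφ'o, hφ'γ, hform'⟩ :=
    F0P3cDyRamEllipticPlaneLineModel.exists_lineModel σ (Matrix.diagonal dg) jE ρ Θ hP3 hP6 hD0 hΔ0 hP14 hP15 hP16 hP18 γ₁ htr' hdet' hirr' hU'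
  have hH2' : ∀ a b, σ ((Matrix.diagonal dg) a b) = (Matrix.diagonal dg) b a := by
    intro a b
    by_cases hab : a = b
    · subst hab; rw [Matrix.diagonal_apply_eq]; exact hA4 a
    · rw [Matrix.diagonal_apply_ne _ hab, Matrix.diagonal_apply_ne _ (Ne.symm hab), map_zero]
  have hΘh' : Θ h' = h' := map_h_eq_h_of_hermitian σ hσσ hH2' jE hP7 hP8 hP6 hP10 φ' hφ'o hform'
  have hdet2' : IsUnit (Matrix.diagonal dg).det := by
    rw [Matrix.det_diagonal, Fin.prod_univ_two, isUnit_iff_ne_zero]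
    have h0 : dg 0 ≠ 0 := fun h0 => by have := hA3 0; rw [h0, map_zero] at this; exact zero_ne_one this
    have h1 : dg 1 ≠ 0 := fun h1 => by have := hA3 1; rw [h1, map_zero] at this; exact zero_ne_one this
    exact mul_ne_zero h0 h1
  have hh' : h' ≠ 0 := h_ne_zero_of_isUnit_det σ hdet2' jE φ' hform'
  -- THE VALUE DICTIONARY of `jE = ι_{w₁}` (ramification index `e ≠ 0`)
  have hje : ∀ x, Valued.v (jE x) = Valued.v x ^ (w.1.asIdeal.ramificationIdx' w₁.1.asIdeal) := fun x => valued_toPlace w.1 w₁ x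
  have he0 : w.1.asIdeal.ramificationIdx' w₁.1.asIdeal ≠ 0 := by
    intro h0
    have h1 := hje 0
    rw [map_zero, map_zero, h0, pow_zero] at h1
    exact zero_ne_one h1
  have hjpow : ∀ (t : (w.1.adicCompletion L)) (n : ℤ), Valued.v (jE t) = Valued.v (jE ϖ) ^ n ↔ Valued.v t = Valued.v ϖ ^ n :=
    fun t n => v_map_eq_zpow_iff jE he0 hje ϖ t n
  have hEval : ∀ c : (w₁.1.adicCompletion E'), ρ c = c → c ≠ 0 → Valued.v c ≤ 1 → ∃ n : ℕ, Valued.v c = Valued.v (jE ϖ) ^ n :=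
    fun c hc hc0 hc1 => exists_v_eq_pow_of_fixed jE he0 hje hϖ hP5 c hc hc0 hc1
  have hϖmax : ∀ t : (w₁.1.adicCompletion E'), ρ t = t → Valued.v t < 1 → Valued.v t ≤ Valued.v (jE ϖ) :=
    fun t ht ht1 => v_le_map_of_fixed_of_lt_one jE he0 hje hϖ hP5 t ht ht1
  exact hL γH hγ hreg hirr E' c₁ δ m₀ s w₁ hw₁ Θ α lam hc₁1 hc₁ hδ0 hmδ hs hΔ hDσ htσ hirr' hP1 hP2 hP3 hP4 hP5 hP6 hP7 hP8 hP9 hP10 hP11 hP12 hP13 hP14 hP15 hP16 hP17 hP18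
    th ta P₁ dg η γ₁ hth hA1 hA2 hA3 hA4 hA7 hA8 hA9 hA10 hA11 hA12 φ h φ' h' hφs hφi hφo hφγ hform hΘh hh hhyper hφ's hφ'i hφ'o hφ'γ hform' hΘh' hh' hjpow hEval hϖmax

end Summit.HodgeConjecture.HodgeConjecture.Cruxes.H413.F0P3cDyRamFixedPointCensusTypeTwoCensusOfLineModels

end
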